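import Literature.NumberTheory.LFunctions.WeilExplicit
import Literature.NumberTheory.LFunctions.WeilExplicitProofs
import Literature.NumberTheory.LFunctions.WeilMellinInversion
import Literature.NumberTheory.LFunctions.WeilArchimedeanPositivityProofs
import Literature.NumberTheory.LFunctions.WeilArchimedeanMoments
import Literature.NumberTheory.LFunctions.WeilFirstPrimeQuadratic

/-!
# Stub `stub_combPairing` for crux `SignCone.SignConeOscillatory` (stmt-RiemannHypothesis-16302), line Sketch

Write `ĝ(y) := weilMellin g (1/2 + iy)` (the Fourier transform of the Weil test function `g`) and
`k := weilConv g (weilReflect g) = g ⋆ g̃`, so that `k̂(1/2 + iy) = |ĝ(y)|²` on the critical line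
(`weilMellin_weilConv_weilReflect_half`). Mellin (= Fourier) inversion for `k` at `t = ± L`
(`weilMellin_inversion`) gives `2π (k(L) + k(-L)) = ∫ |ĝ(y)|² · 2cos(yL) dy`
(`two_pi_mul_weilConv_weilReflect_add_neg`, the model being the case `L = log 2`,
`weilConv_weilReflect_log_two_add`), and hermitian symmetry `conj k(-L) = k(L)`
(`conj_weilConv_weilReflect_neg`) turns `k(L) + k(-L)` into `2 Re k(L)`
(`two_pi_mul_two_re_weilConv_weilReflect`). Summing over the "fake prime" cosine comb
`Σ_{2 ≤ n ≤ N} cₙ · 2cos(y log n)/√n` yields the node values `Σ cₙ · 2 Re k(log n)/√n`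
(`stub_combPairing`).
-/

noncomputable section
set_option linter.dupNamespace false
open scoped BigOperators ComplexConjugate Real
open Complex MeasureTheory Set Filter

namespace Summit.RiemannHypothesis.RiemannHypothesis.Theorems.SignConeOscillatory

open Literature.NumberTheory.LFunctions

/-- Mellin inversion on the critical line for the kernel `k = g ⋆ g̃` at `t = ± L`:
`2π (k(L) + k(−L)) = ∫ |ĝ(1/2+it)|² · 2cos(t L) dt` (as complex numbers); the case `L = log 2` is
`weilConv_weilReflect_log_two_add`. -/
theorem two_pi_mul_weilConv_weilReflect_add_neg {g : ℝ → ℂ} (hg : IsWeilTest g) (L : ℝ) :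
    2 * π * (weilConv g (weilReflect g) L + weilConv g (weilReflect g) (-L)) =
      ((∫ t : ℝ, ‖weilMellin g (1 / 2 + t * I)‖ ^ 2 * (2 * Real.cos (t * L)) : ℝ) : ℂ) := by
  -- adapted from `Literature.NumberTheory.LFunctions.weilConv_weilReflect_log_two_add`
  have hk : IsWeilTest (weilConv g (weilReflect g)) := hg.weilConv hg.weilReflect
  have h1 := weilMellin_inversion hk (1 / 2) L
  have h2 := weilMellin_inversion hk (1 / 2) (-L)
  have e0 : ((1 / 2 : ℝ) : ℂ) - 1 / 2 = 0 := by push_cast; ring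
  simp only [e0, zero_mul, Complex.exp_zero, mul_one] at h1 h2
  have hb1 : ∀ y : ℝ, ‖cexp (-(y * I) * (L : ℂ))‖ ≤ 1 := fun y => by
    rw [show -(y * I : ℂ) * (L : ℂ) = ((-(y * L) : ℝ) : ℂ) * I by push_cast; ring,
      Complex.norm_exp_ofReal_mul_I]
  have hb2 : ∀ y : ℝ, ‖cexp (-(y * I) * ((-L : ℝ) : ℂ))‖ ≤ 1 := fun y => by
    rw [show -(y * I : ℂ) * ((-L : ℝ) : ℂ) = (((y * L) : ℝ) : ℂ) * I by push_cast; ring,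
      Complex.norm_exp_ofReal_mul_I]
  have hi1 : Integrable fun y : ℝ =>
      weilMellin (weilConv g (weilReflect g)) ((1 / 2 : ℝ) + y * I) * cexp (-(y * I) * (L : ℂ)) :=
    integrable_weilMellin_vertical_mul hk (1 / 2) (by fun_prop) hb1
  have hi2 : Integrable fun y : ℝ =>
      weilMellin (weilConv g (weilReflect g)) ((1 / 2 : ℝ) + y * I) * cexp (-(y * I) * ((-L : ℝ) : ℂ)) :=
    integrable_weilMellin_vertical_mul hk (1 / 2) (by fun_prop) hb2
  rw [mul_add, ← h1, ← h2, ← integral_add hi1 hi2, ← integral_complex_ofReal]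
  congr 1 with t
  have ht : ((1 / 2 : ℝ) : ℂ) + t * I = 1 / 2 + t * I := by push_cast; ring
  rw [ht, weilMellin_weilConv_weilReflect_half hg t]
  have hcos : cexp (-(t * I) * (L : ℂ)) + cexp (-(t * I) * ((-L : ℝ) : ℂ)) =
      ((2 * Real.cos (t * L) : ℝ) : ℂ) := by
    have e1 : -(t * I : ℂ) * (L : ℂ) = -((t * L : ℝ) : ℂ) * I := by push_cast; ring
    have e2 : -(t * I : ℂ) * ((-L : ℝ) : ℂ) = ((t * L : ℝ) : ℂ) * I := by push_cast; ring
    rw [e1, e2, add_comm, ← Complex.two_cos]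
    push_cast
    ring
  rw [← mul_add, hcos]
  push_cast
  ring

/-- Hermitian symmetry of `k = g ⋆ g̃`: `k(L) + k(-L) = 2 Re k(L)` (from `conj k(-L) = k(L)`). -/
theorem weilConv_weilReflect_add_neg_eq_two_re (g : ℝ → ℂ) (L : ℝ) :
    weilConv g (weilReflect g) L + weilConv g (weilReflect g) (-L) =
      ((2 * (weilConv g (weilReflect g) L).re : ℝ) : ℂ) := by
  have h : weilConv g (weilReflect g) (-L) = conj (weilConv g (weilReflect g) L) := by
    rw [← conj_weilConv_weilReflect_neg g L, Complex.conj_conj]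
  rw [h, Complex.add_conj]

/-- The single-node identity, real form: `2π · 2 Re k(L) = ∫ |ĝ(1/2+it)|² · 2cos(t L) dt` for
`k = g ⋆ g̃`. -/
theorem two_pi_mul_two_re_weilConv_weilReflect {g : ℝ → ℂ} (hg : IsWeilTest g) (L : ℝ) :
    2 * π * (2 * (weilConv g (weilReflect g) L).re) =
      ∫ t : ℝ, ‖weilMellin g (1 / 2 + t * I)‖ ^ 2 * (2 * Real.cos (t * L)) := by
  have h := two_pi_mul_weilConv_weilReflect_add_neg hg L
  rw [weilConv_weilReflect_add_neg_eq_two_re] at h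
  exact_mod_cast h

/-- The single-node identity at `L = log n`, normalised:
`(1/2π) ∫ |ĝ(1/2+it)|² · 2cos(t log n) dt = 2 Re k(log n)` for `k = g ⋆ g̃`. -/
theorem inv_two_pi_mul_integral_norm_sq_weilMellin_mul_two_cos {g : ℝ → ℂ} (hg : IsWeilTest g)
    (L : ℝ) :
    1 / (2 * π) * ∫ t : ℝ, ‖weilMellin g (1 / 2 + t * I)‖ ^ 2 * (2 * Real.cos (t * L)) =
      2 * (weilConv g (weilReflect g) L).re := by
  rw [← two_pi_mul_two_re_weilConv_weilReflect hg L]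
  have hpi : (2 * π : ℝ) ≠ 0 := by positivity
  field_simp

/-- Each cosine mode against the spectral density is integrable:
`t ↦ |ĝ(1/2+it)|² · 2cos(t L)` is integrable (`|2 cos| ≤ 2`, `|ĝ|²` has quartic decay). -/
theorem integrable_norm_sq_weilMellin_mul_two_cos {g : ℝ → ℂ} (hg : IsWeilTest g) (L : ℝ) :
    Integrable fun t : ℝ => ‖weilMellin g (1 / 2 + t * I)‖ ^ 2 * (2 * Real.cos (t * L)) :=
  integrable_norm_sq_weilMellin_mul hg (by fun_prop) (A := 2) (B := 0) (by norm_num) le_rfl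
    fun t => by
      rw [zero_mul, add_zero, abs_mul, abs_two]
      exact mul_le_of_le_one_right (by norm_num) (Real.abs_cos_le_one _)

/-- A weighted cosine mode against the spectral density is integrable:
`t ↦ |ĝ(1/2+it)|² · (c · 2cos(t log n) / √n)`. -/
theorem integrable_norm_sq_weilMellin_mul_comb_summand {g : ℝ → ℂ} (hg : IsWeilTest g) (a L r : ℝ) :
    Integrable fun t : ℝ =>
      ‖weilMellin g (1 / 2 + t * I)‖ ^ 2 * (a * (2 * Real.cos (t * L)) / r) := by
  have h := ((integrable_norm_sq_weilMellin_mul_two_cos hg L).const_mul a).div_const r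
  refine h.congr (Eventually.of_forall fun t => ?_)
  simp only
  ring

/-- STUB `stub_combPairing` (the cosine comb pairs to node values). Mellin inversion on the critical
line for `k = g ⋆ g̃`: `(1/2π) ∫ |ĝ(y)|² · 2cos(y log n) dy = k(log n) + k(-log n) = 2 Re k(log n)`,
summed against the weights `cₙ/√n` over `2 ≤ n ≤ N`; the integrand is integrable. -/
theorem stub_combPairing :
    ∀ (g : ℝ → ℂ) (N : ℕ) (c : ℕ → ℝ), IsWeilTest g →
      Integrable (fun y : ℝ => ‖weilMellin g (1 / 2 + y * I)‖ ^ 2 *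
          ∑ n ∈ Finset.Icc 2 N, c n * (2 * Real.cos (y * Real.log n)) / Real.sqrt n) ∧
      1 / (2 * π) * ∫ y : ℝ, ‖weilMellin g (1 / 2 + y * I)‖ ^ 2 *
          ∑ n ∈ Finset.Icc 2 N, c n * (2 * Real.cos (y * Real.log n)) / Real.sqrt n
        = ∑ n ∈ Finset.Icc 2 N,
            c n * (2 * (weilConv g (weilReflect g) (Real.log n)).re) / Real.sqrt n := by
  intro g N c hg
  have hs : ∀ n ∈ Finset.Icc 2 N, Integrable fun y : ℝ =>
      ‖weilMellin g (1 / 2 + y * I)‖ ^ 2 * (c n * (2 * Real.cos (y * Real.log n)) / Real.sqrt n) :=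
    fun n _ => integrable_norm_sq_weilMellin_mul_comb_summand hg (c n) (Real.log n) (Real.sqrt n)
  simp_rw [Finset.mul_sum]
  refine ⟨integrable_finsetSum _ hs, ?_⟩
  rw [integral_finsetSum _ hs, Finset.mul_sum]
  refine Finset.sum_congr rfl fun n _ => ?_
  have e : (fun y : ℝ =>
      ‖weilMellin g (1 / 2 + y * I)‖ ^ 2 * (c n * (2 * Real.cos (y * Real.log n)) / Real.sqrt n)) =
      fun y : ℝ => c n / Real.sqrt n *
        (‖weilMellin g (1 / 2 + y * I)‖ ^ 2 * (2 * Real.cos (y * Real.log n))) := by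
    funext y
    ring
  rw [e, integral_const_mul, mul_left_comm,
    inv_two_pi_mul_integral_norm_sq_weilMellin_mul_two_cos hg (Real.log n)]
  ring

end Summit.RiemannHypothesis.RiemannHypothesis.Theorems.SignConeOscillatory

end
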